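import Summits.QuantumFields.BalabanUV.T4Continuum.Support.NE3QuadRemainderLocality
import Summits.QuantumFields.BalabanUV.T4Continuum.Support.NE3QuadRemainderSup
import HarnessLib

/-!
# T⁴ programme, node NE3, route Π item Π-C (file Π-C-3c «LOCAL END») — THE k-FOLD QUADRATIC REMAINDER IN LOCAL SUP FORM:
# `‖C_W^{(k)}(X)(z,κ)‖ ≤ C₂(d,L)·(L^k·sup_{B̃_k(z)}‖X‖)²`, `B̃_k(z)` = the ℓ¹-ball of radius `depRad d L k` about `L^k•z`, k-FREE

NE3 formalisation swarm `b2b-balaban-t4-ne3-formalise-*`, LEAF PROVER 02 (gen 7); the LOCAL form asked by the OWNER's ruling ρ-g25-1 (1) (HOME/CLAIMS.log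
l.22520): Π-C-3b's global-sup END (`NE3QuadRemainderSup.norm_relIter_sub_dirIter_le`) applied to the PERIODISED cut-off of `X` to the dependency ball (the END
needs a periodic direction, so the cut-off is periodised along the torus lattice `(L^K·N)·ℤ^d`; by periodicity of `X` its sup is the sup of `X` over the ball
itself) and Π-C-3♭'s locality (`NE3QuadRemainderLocality.remainder_congr_of_l1`).

CONTENT (all [folklore]; 0 sorry; ONE DATA def `cutDir`): §1 `cutDir P R c X` (the `P`-periodised cut-off of `X` to the ℓ¹-ball of radius `R` about `c`),
`cutDir_eq_of_l1` (agrees with `X` on the ball), `cutDir_skew`, `cutDir_periodic`, `norm_le_of_periodic` (a `P`-periodic `X` bounded by `s` on the ball is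
bounded by `s` on every lattice translate), `norm_cutDir_le`; §2 **`norm_relIter_sub_dirIter_le_local`**: under Π-C-3b's tower-class hypotheses with the GLOBAL
sup hypothesis replaced by the LOCAL one `∀ x μ, l1 (x − L^k•z) ≤ depRad d L k → ‖X x μ‖ ≤ s` (and the smallness line (σ) with this local `s`):
`‖relIter L k W X z κ − dirIter L k W X z κ‖ ≤ 4(3+12d)³∕rho0² · (L^k·s)²` for every `κ`.

HONEST FRAMING.  Bookkeeping on OUR frame; nothing about Bałaban's minimisers; the conversion of LOCAL sup letters into `DecomposedRep`'s relative sizes is the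
owner's (Π-REG ∕ assembly); T-E_w♯, NE3 NOT proved; spine PROVED 0∕9; finite T⁴ rung (B)+1 — NOT infinite volume, NOT mass gap, NOT BetaPertH, NOT Clay.
ABSOLUTE RULE kept (context only: [Balaban1985Averaging] p. 24, Prop. 4 (134)–(135) p. 38 «analytic function of the variables A_b, b ⊂ B_k(c₋) ∪ B_k(c₊)»).
PLACEMENT: `Summits/QuantumFields/BalabanUV/`.  HONEST DEPENDENCY: continuum YM on T⁴ ⇐ BetaPertH ∧ nine spine estimates (0/9 proved); BetaPertH ⇐ (D1) ∧ (D4) ∧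
CAP+tail; G-an2-4 gates asym, D1 and NE2/3/4.
-/

set_option autoImplicit false

open scoped BigOperators Matrix.Norms.L2Operator
open Finset

namespace Summit.QuantumFields.BalabanUV.T4Continuum.NE3QuadRemainderLocal

open Literature.MathematicalPhysics.QuantumFieldTheory.Balaban1983to89
open B7Prop1Explicit B7Prop2Explicit
open T4AveragingDeficitWall (IsUnitaryCfg IsSkewDir SmallField)
open T4AveragingDeficitWallBoundary (IsPeriodicCfg)
open AveragingDeficitPeriodicCounting (IsPeriodicDir)
open AveragingDeficitTorusChart (periodic_smul_vec)
open AveragingDeficitMultiLevelPrep (cavgIter LevelSmall)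
open BlockAverageVaryDisc (rho0)
open NE3TangentCovariantTower (dirIter)
open NE3LinearisedAverageSup (curvSum)
open NE3QuadRemainderTower (relIter)
open NE3QuadRemainderLocality (depRad remainder_congr_of_l1)
open NE3QuadRemainderSup (norm_relIter_sub_dirIter_le)

noncomputable section

variable {d : ℕ} {n : Type*} [Fintype n] [DecidableEq n]

/-! ## §1 The periodised cut-off -/

/-- THE `P`-PERIODISED CUT-OFF of a direction field to the ℓ¹-ball of radius `R` about `c`: `X` on every lattice translate `c + P•t + ball`, `0` elsewhere.
[folklore] -/
def cutDir (P : ℤ) (R : ℕ) (c : Site d) (X : Site d → Fin d → Matrix n n ℂ) : Site d → Fin d → Matrix n n ℂ :=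
  fun x μ => by classical exact if ∃ t : Site d, l1 (x - c - P • t) ≤ R then X x μ else 0

omit [Fintype n] [DecidableEq n] in
/-- On the ball itself the cut-off is `X`. [folklore] -/
theorem cutDir_eq_of_l1 (P : ℤ) {R : ℕ} {c : Site d} (X : Site d → Fin d → Matrix n n ℂ) {x : Site d} (hx : l1 (x - c) ≤ R) (μ : Fin d) :
    cutDir P R c X x μ = X x μ := by
  classical
  have h : ∃ t : Site d, l1 (x - c - P • t) ≤ R := ⟨0, by simpa using hx⟩
  simp only [cutDir, h, ↓reduceIte]

omit [Fintype n] [DecidableEq n] in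
/-- The cut-off of a skew field is skew. [folklore] -/
theorem cutDir_skew (P : ℤ) (R : ℕ) (c : Site d) {X : Site d → Fin d → Matrix n n ℂ} (hX : IsSkewDir X) : IsSkewDir (cutDir P R c X) := by
  classical
  intro x μ
  unfold cutDir
  split_ifs
  · exact hX x μ
  · exact (skewAdjoint (Matrix n n ℂ)).zero_mem

omit [Fintype n] [DecidableEq n] in
/-- The cut-off of a `P`-periodic field is `P`-periodic. [folklore] -/
theorem cutDir_periodic {P : ℤ} (R : ℕ) (c : Site d) {X : Site d → Fin d → Matrix n n ℂ} (hX : IsPeriodicDir X P) :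
    IsPeriodicDir (cutDir P R c X) P := by
  classical
  intro x κ μ
  have hiff : (∃ t : Site d, l1 (x + P • e κ - c - P • t) ≤ R) ↔ ∃ t : Site d, l1 (x - c - P • t) ≤ R := by
    constructor
    · rintro ⟨t, ht⟩
      refine ⟨t - e κ, ?_⟩
      rwa [show x - c - P • (t - e κ) = x + P • e κ - c - P • t by rw [smul_sub]; abel]
    · rintro ⟨t, ht⟩
      refine ⟨t + e κ, ?_⟩
      rwa [show x + P • e κ - c - P • (t + e κ) = x - c - P • t by rw [smul_add]; abel]
  unfold cutDir
  rw [hX x κ μ]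
  simp only [hiff]

/-- A `P`-periodic field bounded by `s` on the ball is bounded by `s` on every lattice translate of the ball. [folklore] -/
theorem norm_le_of_periodic {P : ℤ} {R : ℕ} {c : Site d} {X : Site d → Fin d → Matrix n n ℂ} (hX : IsPeriodicDir X P) {s : ℝ}
    (hloc : ∀ (x : Site d) (μ : Fin d), l1 (x - c) ≤ R → ‖X x μ‖ ≤ s) {x : Site d} (μ : Fin d) {t : Site d}
    (ht : l1 (x - c - P • t) ≤ R) : ‖X x μ‖ ≤ s := by
  have hper : X x μ = X (x - P • t) μ := by
    have h := periodic_smul_vec (f := fun y => X y μ) (fun y κ => hX y κ μ) (x - P • t) t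
    simp only [sub_add_cancel] at h
    exact h
  rw [hper]
  exact hloc _ μ (by rwa [show x - P • t - c = x - c - P • t by abel])

/-- The sup of the cut-off: `‖cutDir P R c X x μ‖ ≤ s` everywhere, given `s ≥ 0` and the LOCAL bound of the `P`-periodic `X` on the ball. [folklore] -/
theorem norm_cutDir_le {P : ℤ} {R : ℕ} {c : Site d} {X : Site d → Fin d → Matrix n n ℂ} (hX : IsPeriodicDir X P) {s : ℝ} (hs : 0 ≤ s)
    (hloc : ∀ (x : Site d) (μ : Fin d), l1 (x - c) ≤ R → ‖X x μ‖ ≤ s) (x : Site d) (μ : Fin d) : ‖cutDir P R c X x μ‖ ≤ s := by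
  classical
  unfold cutDir
  split_ifs with h
  · obtain ⟨t, ht⟩ := h
    exact norm_le_of_periodic hX hloc μ ht
  · rwa [norm_zero]

/-! ## §2 The local END -/

/-- **THE k-FOLD QUADRATIC REMAINDER, LOCAL SUP FORM, k-FREE.**  Under the tower-class hypotheses of Π-C-3b (`2 ≤ L`, `W` unitary `(L^K·N)`-periodic, `0 ≤ x`,
`LevelSmall d L K x`, `SmallField W x`, `curvSum d L K x ≤ (2∕3)L`), for a skew `(L^K·N)`-periodic `X`, a level `k ≤ K`, a coarse site `z`, and a LOCAL sup
`s ≥ 0` of `X` on the dependency ball `{x : l1 (x − L^k•z) ≤ depRad d L k}` obeying the smallness line `4(3+12d)²·L^K·s ≤ rho0²`: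
`‖relIter L k W X z κ − dirIter L k W X z κ‖ ≤ (4(3+12d)³∕rho0²)·(L^k·s)²` for every `κ`. [cite: Balaban1985Averaging, Prop. 4 (134)–(135) p.38] -/
theorem norm_relIter_sub_dirIter_le_local [Nonempty n] {L N K : ℕ} [NeZero N] (hL : 2 ≤ L) {W : Site d → Fin d → (Matrix n n ℂ)ˣ} {x : ℝ}
    (hWu : IsUnitaryCfg W) (hWP : IsPeriodicCfg W ((L ^ K * N : ℕ) : ℤ)) (hx : 0 ≤ x) (hsm : LevelSmall d L K x) (hWx : SmallField W x)
    (hA : curvSum d L K x ≤ 2 / 3 * L) {X : Site d → Fin d → Matrix n n ℂ} (hXs : IsSkewDir X) (hXP : IsPeriodicDir X ((L ^ K * N : ℕ) : ℤ))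
    {k : ℕ} (hk : k ≤ K) (z : Site d) {s : ℝ} (hs : 0 ≤ s)
    (hloc : ∀ (y : Site d) (μ : Fin d), l1 (y - ((L : ℤ) ^ k) • z) ≤ depRad d L k → ‖X y μ‖ ≤ s)
    (hσ : 4 * (3 + 12 * (d : ℝ)) ^ 2 * (L : ℝ) ^ K * s ≤ rho0 d L ^ 2) (κ : Fin d) :
    ‖relIter L k W X z κ - dirIter L k W X z κ‖ ≤ 4 * (3 + 12 * (d : ℝ)) ^ 3 / rho0 d L ^ 2 * ((L : ℝ) ^ k * s) ^ 2 := by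
  set X' := cutDir ((L ^ K * N : ℕ) : ℤ) (depRad d L k) (((L : ℤ) ^ k) • z) X with hX'
  have hX's : IsSkewDir X' := cutDir_skew _ _ _ hXs
  have hX'P : IsPeriodicDir X' ((L ^ K * N : ℕ) : ℤ) := cutDir_periodic _ _ hXP
  have hX'sup : ∀ (y : Site d) (μ : Fin d), ‖X' y μ‖ ≤ s := norm_cutDir_le hXP hs hloc
  have hagree : ∀ (y : Site d) (μ : Fin d), l1 (y - ((L : ℤ) ^ k) • z) ≤ depRad d L k → X y μ = X' y μ :=
    fun y μ hy => (cutDir_eq_of_l1 _ X hy μ).symm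
  rw [remainder_congr_of_l1 L k W z hagree κ]
  exact norm_relIter_sub_dirIter_le hL hWu hWP hx hsm hWx hA hX's hX'P hs hX'sup hσ k hk z κ

end

end Summit.QuantumFields.BalabanUV.T4Continuum.NE3QuadRemainderLocal
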